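import Literature.NumberTheory.EllipticCurves.ShimuraSubgroupHeckeCongruence
import Literature.NumberTheory.EllipticCurves.CuspFormLFunctionLevelConductorProofs
import Literature.NumberTheory.EllipticCurves.ModularDegreeQuadraticTwistProofs
import Literature.NumberTheory.EllipticCurves.PAdicLFunctionNeZeroProofs
import Summits.BirchSwinnertonDyer.BirchSwinnertonDyer.Theorems.AlignedTransportAtTwoMainConjectureTransportAlignedAtTwoLocalTerms
import HarnessLib

/-!
# Stub `stub_levelDetect` of line `nsf` on the crux `StarOptBNSF` (item stmt-BirchSwinnertonDyer-27047) — PROVED;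
# and its consequence for the Shimura cover: at a non-squarefree odd conductor `Λ₀(f)/Λ₁(f)` has no `2`-torsion

Line `nsf` (planner bsd-rank2-p2 GEN 31, skeleton `Cruxes/StarOptBNSF/Lines/nsf.lean`, registered 2026-08-28T09:38Z on
stmt-BirchSwinnertonDyer-27047, child of the load-bearing crux E1M_NSF stmt-27021 of route `EisensteinDepletionAtTwo`):
`StarOptBNSF ⇐ stub_thmAShadow ∧ stub_levelDetect ∧ stub_regimeTransport` (composition `StarOptBNSF_of` kernel-checked by
the planner).  THIS FILE closes the registered stub

  `stub_levelDetect : ∀ W f, IsNewformOf W f → (IsOrdinaryAt W 2 → ¬ 2 ∣ N) ∧ ∀ p prime, p² ∣ N_W → p ∣ N ∧ a_p(f) = 0`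

— LEVEL DETECTION FROM FOURIER COEFFICIENTS, replacing Carayol's «level = conductor» (only a named fact in the tree,
`IsNewformOf.level_eq_conductorNorm`): (i) good reduction at `2` ⇒ `2 ∤ N` is the tree's Carayol-free
`Literature.NumberTheory.EllipticCurves.not_dvd_level_of_isNewformOf` (`a_{p²}(f) = a_p(f)²` if `p ∣ N` vs
`a_{p²}(W) = a_p² − p` at a good prime); (ii) `p² ∣ N_W` ⇒ `ord_p N_W ≥ 2` ⇒ `W` neither good nor multiplicative at `p`
(Silverman ATAEC IV.10.2, tree `factorization_conductorNorm_eq_zero_iff` / `…_eq_one_iff`) ⇒ `a_p(W) = 0`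
(AEC C.16, tree `WeierstrassCurve.LFunction_apply_eq_zero_of_not_good_of_not_mult`) ⇒ `a_p(f) = 0` (`IsNewformOf`), and
`p ∣ N_W ⇒ p ∣ N` (prime support of level = of conductor, tree `IsNewformOf.dvd_level_iff_dvd_conductorNorm`, Carayol-free).

§3 records what the stub is FOR (the NSF mechanism of the line, HOME/p2/g29/OPTB-VIA-SIGMA.md §3 / p2 GEN 30
NSF-DOOR.md Layer 2a LEMMA (ii)), as by-name kernel lemmas in the tree's period-lattice avatar of the Shimura cover
(`Λ₁(f) = periodLatticeGamma1 f ≤ Λ₀(f) = periodLattice f`; `E₁ = ℂ/Λ₁(f) → E₀ = ℂ/Λ₀(f)` is Stevens' `X₁(N)`-optimal curve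
over the `X₀(N)`-optimal curve, kernel `Λ₀/Λ₁` Cartier dual to `E₀ ∩ Σ_N`, Vatsal 2005 Rem. 1.8): Ling–Oesterlé's Thm. 6
«`T_p = p` on `Σ(N)` for `p ∣ N`» is the tree theorem `heckeEigenPeriodCongruence_holds` with corollary
`pMulLatticeLeGamma1OfTracelessPrime_holds` (`a_p = 0`, `p ∣ N` ⇒ `p Λ₀(f) ⊆ Λ₁(f)`; cell bsd-f2-manin 2026-08-27), whence for
an ODD such `p`: every `z ∈ Λ₀(f)` with `2z ∈ Λ₁(f)` lies in `Λ₁(f)` — `Λ₀(f)/Λ₁(f)` has no element of order `2`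
(`mem_periodLatticeGamma1_of_two_mul_mem_of_traceless`, `…_of_sq_dvd_conductorNorm`, `…_of_starOptBNSF_binders` — the last
under EXACTLY the binders `IsOrdinaryAt W 2`, `¬ Squarefree N_W`, `IsNewformOf W f` of `StarOptBNSF`).

HONEST FRAMING: stub 2 of 3 (size M, bookkeeping); the research stub `stub_thmAShadow` (THEOREM A's elliptic shadow:
unbounded denominators `Literature.NumberTheory.Automorphic.CalegariDimitrovTang2025_unboundedDenominators` — a NAMED FACT —
on `X_μ(N)`, Wohlfahrt `Literature.NumberTheory.Automorphic.CongruenceSubgroup.Gamma_le_of_isCongruenceSubgroup_of_forall_conj_T_pow_mem`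
— PROVED —, Oort–Tate; no Néron-model vocabulary in the tree) and `stub_regimeTransport` are untouched.  All theorems
here are fact-free (standard axioms).  Nothing here proves `StarOptBNSF`, E1M_NSF or BSD.

References: S. Ling, J. Oesterlé, *The Shimura subgroup of `J₀(N)`*, Astérisque 196–197 (1991) 171–203, Thm. 6
[LingOesterle1991]; A. Atkin, J. Lehner, Math. Ann. 185 (1970), Thm. 3 [AtkinLehner1970]; V. Vatsal, J. Inst. Math.
Jussieu 4 (2005), Rem. 1.8 [Vatsal2005]; J. Silverman, ATAEC IV.10.2 [Silverman1994], AEC C.16 [SilvermanAEC2009];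
F. Diamond, J. Shurman, GTM 228, Prop. 5.8.5 and (8.44) [DiamondShurman2005].
-/

set_option linter.dupNamespace false
set_option autoImplicit false

open scoped MatrixGroups
open CongruenceSubgroup Literature.NumberTheory.EllipticCurves Literature.NumberTheory.EllipticCurves.ModularForms

namespace Summit.BirchSwinnertonDyer.BirchSwinnertonDyer.Theorems.EisensteinDepletionAtTwoStarOptBNSFStubLevelDetect

/-! ### §1 `p² ∣ N_W`: additive reduction, `a_p(f) = 0`, `p ∣ N` -/

section Curves

variable {N : ℕ} [NeZero N] {W : WeierstrassCurve ℚ} [W.IsElliptic] {f : CuspForm (Gamma0 N) 2}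

/-- `p² ∣ N_W ⇒ W` is neither good nor multiplicative at `p` (`ord_p N_W ≥ 2`; Silverman ATAEC IV.10.2 (a), (b) in the
tree's prime-indexed form `factorization_conductorNorm_eq_zero_iff` / `…_eq_one_iff`). [cite: Silverman1994, IV.10.2] -/
theorem not_good_not_mult_of_sq_dvd_conductorNorm {p : ℕ} [hp : Fact p.Prime] (hsq : p ^ 2 ∣ W.conductorNorm ℤ) :
    ¬ W.HasGoodReductionAtPrime p ∧ ¬ W.HasMultiplicativeReductionAtPrime p := by
  have hN0 : W.conductorNorm ℤ ≠ 0 := (W.conductorNorm_pos_holds).ne'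
  have h2 : 2 ≤ (W.conductorNorm ℤ).factorization p := (hp.out.pow_dvd_iff_le_factorization hN0).mp hsq
  refine ⟨fun hg ↦ ?_, fun hm ↦ ?_⟩
  · have h0 := (AlignedTransportAtTwoLocalTerms.factorization_conductorNorm_eq_zero_iff W).mpr hg
    omega
  · have h1 := (AlignedTransportAtTwoLocalTerms.factorization_conductorNorm_eq_one_iff W).mpr hm
    omega

/-- **`p² ∣ N_W ⇒ a_p(f) = 0`** for the newform `f` of an elliptic `W/ℚ` at ANY level (`IsNewformOf W f` gives
`a_p(f) = a_p(W)`, and `a_p(W) = 0` at a prime of additive reduction: Silverman AEC C.16, tree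
`WeierstrassCurve.LFunction_apply_eq_zero_of_not_good_of_not_mult`). No Carayol input.
[cite: SilvermanAEC2009, App. C §16 (L_v(T) = 1 at an additive place)] -/
theorem cuspCoeff_eq_zero_of_sq_dvd_conductorNorm (hf : IsNewformOf W f) {p : ℕ} (hp : p.Prime)
    (hsq : p ^ 2 ∣ W.conductorNorm ℤ) : cuspCoeff f p = 0 := by
  haveI : Fact p.Prime := ⟨hp⟩
  obtain ⟨hng, hnm⟩ := not_good_not_mult_of_sq_dvd_conductorNorm (W := W) hsq
  rw [hf.2 p, W.LFunction_apply_eq_zero_of_not_good_of_not_mult p hng hnm (dvd_refl p), Int.cast_zero]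

/-- **`p² ∣ N_W ⇒ p ∣ N`** for the level `N` of the newform of `W` (prime support of the level = of the conductor, tree
`IsNewformOf.dvd_level_iff_dvd_conductorNorm`; no Carayol input). [cite: DiamondShurman2005, Prop. 5.8.5 and (8.44)] -/
theorem dvd_level_of_sq_dvd_conductorNorm (hf : IsNewformOf W f) {p : ℕ} (hp : p.Prime)
    (hsq : p ^ 2 ∣ W.conductorNorm ℤ) : p ∣ N :=
  (hf.dvd_level_iff_dvd_conductorNorm hp).mpr ((dvd_pow_self p two_ne_zero).trans hsq)

/-- **Good ordinary at `2 ⇒ 2 ∤ N`** for the level of the newform of a globally minimal `W` (the tree's Carayol-free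
`not_dvd_level_of_isNewformOf` at `p = 2`, applied to the good-reduction half of `IsOrdinaryAt W 2`).
[cite: SilvermanAEC2009, App. C §16] -/
theorem not_two_dvd_level_of_isOrdinaryAt [W.IsGloballyMinimal] (hf : IsNewformOf W f) (hord : IsOrdinaryAt W 2) :
    ¬ 2 ∣ N := by
  haveI : Fact (Nat.Prime 2) := ⟨Nat.prime_two⟩
  exact not_dvd_level_of_isNewformOf hf hord.1

end Curves

/-! ### §2 The registered stub, by name and verbatim signature -/

/-- **STUB `stub_levelDetect` of line `nsf` (crux `StarOptBNSF`, stmt-BirchSwinnertonDyer-27047) — PROVED.**  For a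
globally minimal elliptic `W/ℚ` and its newform `f` at any level `N` (`IsNewformOf W f`): (i) `W` good ordinary at
`2 ⇒ 2 ∤ N`; (ii) for every prime `p` with `p² ∣ N_W`: `p ∣ N` and `a_p(f) = 0`.  Level detection from Fourier
coefficients — no «level = conductor» (Carayol) input. [cite: SilvermanAEC2009, App. C §16] [cite: DiamondShurman2005, Prop. 5.8.5 and (8.44)] -/
theorem stub_levelDetect : ∀ (W : WeierstrassCurve ℚ) [W.IsElliptic] [W.IsGloballyMinimal] ⦃N : ℕ⦄ [NeZero N] (f : CuspForm (CongruenceSubgroup.Gamma0 N) 2), IsNewformOf W f → (IsOrdinaryAt W 2 → ¬ 2 ∣ N) ∧ ∀ p : ℕ, p.Prime → p ^ 2 ∣ W.conductorNorm ℤ → p ∣ N ∧ cuspCoeff f p = 0 := by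
  intro W _ _ N _ f hf
  exact ⟨fun hord ↦ not_two_dvd_level_of_isOrdinaryAt hf hord,
    fun p hp hsq ↦ ⟨dvd_level_of_sq_dvd_conductorNorm hf hp hsq, cuspCoeff_eq_zero_of_sq_dvd_conductorNorm hf hp hsq⟩⟩

/-! ### §3 What the stub feeds: `Λ₀(f)/Λ₁(f)` (the Shimura-cover kernel) has no `2`-torsion at an odd traceless prime -/

/-- If `p z ∈ S` and `2 z ∈ S` for an additive subgroup `S` of `ℂ` and an ODD natural number `p`, then `z ∈ S`
(`z = p z − k (2 z)` for `p = 2k + 1`). [folklore] -/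
theorem mem_of_odd_natCast_mul_mem_of_two_mul_mem {S : AddSubgroup ℂ} {p : ℕ} (hp : Odd p) {z : ℂ}
    (hpz : (p : ℂ) * z ∈ S) (h2z : 2 * z ∈ S) : z ∈ S := by
  obtain ⟨k, hk⟩ := hp
  have hkz : (k : ℂ) * (2 * z) ∈ S := by
    rw [← nsmul_eq_mul]; exact S.nsmul_mem h2z k
  have hz : z = (p : ℂ) * z - (k : ℂ) * (2 * z) := by
    rw [hk]; push_cast; ring
  rw [hz]
  exact S.sub_mem hpz hkz

section Forms

variable {N : ℕ} [NeZero N]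

/-- **NSF-DOOR LEMMA (ii), period-lattice form.** For a newform `f ∈ S₂(Γ₀(N))`, an ODD prime `p ∣ N` with `a_p(f) = 0`,
and `z ∈ Λ₀(f)` with `2 z ∈ Λ₁(f)`: `z ∈ Λ₁(f)` — the kernel `Λ₀(f)/Λ₁(f)` of the Shimura cover `ℂ/Λ₁(f) → ℂ/Λ₀(f)` has
no element of order `2` (it is killed by `p`: Ling–Oesterlé Thm. 6 in the tree's lattice form
`pMulLatticeLeGamma1OfTracelessPrime_holds`, and `p` is odd).
[cite: LingOesterle1991, Thm. 6 («T_p = p on Σ(N) for p ∣ N»); NSF corollary proved here] -/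
theorem mem_periodLatticeGamma1_of_two_mul_mem_of_traceless {f : CuspForm (Gamma0 N) 2} (hf : IsNewform0 f)
    {p : ℕ} (hp : p.Prime) (hp2 : p ≠ 2) (hpN : p ∣ N) (hap : cuspCoeff f p = 0)
    {z : ℂ} (hz : z ∈ periodLattice f) (h2 : 2 * z ∈ periodLatticeGamma1 f) :
    z ∈ periodLatticeGamma1 f :=
  mem_of_odd_natCast_mul_mem_of_two_mul_mem (hp.odd_of_ne_two hp2)
    (pMulLatticeLeGamma1OfTracelessPrime_holds N f hf p hp hpN hap z hz) h2

/-- **`p² ∣ N`, `p` odd ⇒ `Λ₀(f)/Λ₁(f)` has no `2`-torsion** (`a_p(f) = 0` for `p² ∣ N`: Atkin–Lehner 1970, Thm. 3 = tree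
`IsNewform0.cuspCoeff_eq_zero_of_sq_dvd`). [cite: AtkinLehner1970, Thm. 3] [cite: LingOesterle1991, Thm. 6; NSF corollary proved here] -/
theorem mem_periodLatticeGamma1_of_two_mul_mem_of_sq_dvd_level {f : CuspForm (Gamma0 N) 2} (hf : IsNewform0 f)
    {p : ℕ} (hp : p.Prime) (hp2 : p ≠ 2) (hpN : p ^ 2 ∣ N)
    {z : ℂ} (hz : z ∈ periodLattice f) (h2 : 2 * z ∈ periodLatticeGamma1 f) :
    z ∈ periodLatticeGamma1 f :=
  mem_periodLatticeGamma1_of_two_mul_mem_of_traceless hf hp hp2 ((dvd_pow_self p two_ne_zero).trans hpN)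
    (hf.cuspCoeff_eq_zero_of_sq_dvd hp hpN) hz h2

variable {W : WeierstrassCurve ℚ} [W.IsElliptic] {f : CuspForm (Gamma0 N) 2}

/-- **NSF, curve form.** For an elliptic `W/ℚ` with newform `f` (any level) and an ODD prime `p` with `p² ∣ N_W`:
`Λ₀(f)/Λ₁(f)` has no element of order `2` (§1 + `mem_periodLatticeGamma1_of_two_mul_mem_of_traceless`).
[cite: LingOesterle1991, Thm. 6; NSF corollary proved here] -/
theorem mem_periodLatticeGamma1_of_two_mul_mem_of_sq_dvd_conductorNorm (hf : IsNewformOf W f) {p : ℕ}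
    (hp : p.Prime) (hp2 : p ≠ 2) (hsq : p ^ 2 ∣ W.conductorNorm ℤ)
    {z : ℂ} (hz : z ∈ periodLattice f) (h2 : 2 * z ∈ periodLatticeGamma1 f) :
    z ∈ periodLatticeGamma1 f :=
  mem_periodLatticeGamma1_of_two_mul_mem_of_traceless hf.1 hp hp2 (dvd_level_of_sq_dvd_conductorNorm hf hp hsq)
    (cuspCoeff_eq_zero_of_sq_dvd_conductorNorm hf hp hsq) hz h2

/-- `¬ Squarefree N_W` together with `2 ∤ N` (`N` the level of the newform `f` of `W`) gives an ODD prime `p` with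
`p² ∣ N_W` (a prime square factor exists, and `p = 2` would force `2 ∣ N` by `dvd_level_of_sq_dvd_conductorNorm`). [folklore] -/
theorem exists_odd_prime_sq_dvd_conductorNorm (hf : IsNewformOf W f) (h2 : ¬ 2 ∣ N)
    (hnsf : ¬ Squarefree (W.conductorNorm ℤ)) : ∃ p : ℕ, p.Prime ∧ p ≠ 2 ∧ p ^ 2 ∣ W.conductorNorm ℤ := by
  rw [Nat.squarefree_iff_prime_squarefree] at hnsf
  push Not at hnsf
  obtain ⟨p, hp, hpn⟩ := hnsf
  have hsq : p ^ 2 ∣ W.conductorNorm ℤ := by rwa [sq]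
  refine ⟨p, hp, ?_, hsq⟩
  rintro rfl
  exact h2 (dvd_level_of_sq_dvd_conductorNorm hf hp hsq)

/-- **NSF under EXACTLY the binders of `StarOptBNSF`** (stmt-BirchSwinnertonDyer-27047): `W` globally minimal, good
ordinary at `2`, `¬ Squarefree N_W`, `f` its newform at any level ⇒ `Λ₀(f)/Λ₁(f)` has no element of order `2` (the
Shimura cover of the optimal curve of the class has odd `2`-primary kernel; with the paper DICHOTOMY / `stub_thmAShadow`
this is «no rational `2`-torsion point of `E₀` is formal at `2`» — NOT proved here).
[cite: LingOesterle1991, Thm. 6; NSF corollary proved here] -/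
theorem mem_periodLatticeGamma1_of_two_mul_mem_of_starOptBNSF_binders [W.IsGloballyMinimal]
    (hord : IsOrdinaryAt W 2) (hnsf : ¬ Squarefree (W.conductorNorm ℤ)) (hf : IsNewformOf W f)
    {z : ℂ} (hz : z ∈ periodLattice f) (h2 : 2 * z ∈ periodLatticeGamma1 f) :
    z ∈ periodLatticeGamma1 f := by
  obtain ⟨p, hp, hp2, hsq⟩ :=
    exists_odd_prime_sq_dvd_conductorNorm hf (not_two_dvd_level_of_isOrdinaryAt hf hord) hnsf
  exact mem_periodLatticeGamma1_of_two_mul_mem_of_sq_dvd_conductorNorm hf hp hp2 hsq hz h2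

end Forms

end Summit.BirchSwinnertonDyer.BirchSwinnertonDyer.Theorems.EisensteinDepletionAtTwoStarOptBNSFStubLevelDetect
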